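import Summits.ABC.IUTFork.Conditional.FreyLegendreP6EngineEuler
import Summits.ABC.IUTFork.Conditional.FreyLegendreAdmissibleList
import Summits.ABC.IUTFork.Conditional.AbcOfSHwindowFreyRefutationP6Tier2
import HarnessLib

/-!
# (P6) + INHABITED-DATUM ENGINE, INTERVAL FORM — a whole band `lo ≤ l ≤ hi` of levels from ONE kernel `decide`, with NO level list

PROOF-ONLY file (D-0012; 0 definitions, 0 `Prop` facts, no instance, no notation) of the abc-iut cell (seat abc-iut-w6-d102, gen 9;
row «C:P6-N3-BANDS-INH», successor sub-rows). The list engines `FreyP6Engine.condP6_ratPoint_of_certificate_list[_euler]` (p484675 /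
p519527) and `FreyAdm.nonempty_thetaVolumeDatumAt_triple_list` take an EXPLICIT list `L` of levels, spelled several times per file; with
the tree's 400-line cap that is ≈ 290 levels per file (recipe v2, HOME/staging/w6/w6-d102/g8/RECIPE-band-nonvacuity-v2.md), i.e. ≈ 35
files per 10⁴ levels. This file removes the list:
* `FreyP6Engine.condP6_ratPoint_of_certificates_euler` — the Euler-form list engine with a LIST OF CERTIFICATES `Certs : List (ℕ × ℤ × ℕ)`
  (entries `(p, a_p, m)` with `p` a good prime, `a_p` its Frobenius trace, `m = 4p − a_p²`) and the per-level hypothesis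
  `∃ t ∈ Certs, t.1 ≠ l ∧ (t.2.2 % l)^(l/2) % l = (l ≡ 1 mod 4 ? l − 1 : 1)` — ONE `decide` serves a whole list with several certificates
  (no per-certificate sub-lists, no glue step).
* `FreyP6Engine.gcd_eq_one_of_prime_of_forall_lt` — a prime `l ≥ lo` is coprime to any product `P` of numbers `0 < p < lo`; with `P` the
  product of all primes `< lo` and `hi < (next prime)²` the condition `Nat.gcd l P = 1` is an exact and KERNEL-CHEAP primality filter on
  `[lo, hi]` (one GMP `gcd` per integer) — only the direction «prime ⇒ coprime» is needed and proved.
* `FreyP6Engine.condP6_ratPoint_interval_euler` — **(P6) on a whole interval**: from ONE kernel `decide` of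
  `∀ l ∈ List.range' lo (hi + 1 − lo), Nat.gcd l P = 1 → ∃ t ∈ Certs, …` (the kernel walks the integers of `[lo, hi]` lazily; measured
  2026-08-27 on the farm: 58,873 integers / 5,916 primes in ≈ 15 s) conclude `∀ l, l.Prime → lo ≤ l → l ≤ hi → Cor22.CondP6 (ratPoint λ) l`,
  the side conditions `q ∤ l`, `l ∤ k`, `p ≠ l`, `l ∤ 46080` being discharged STRUCTURALLY from `q, k < lo`, `7 ≤ lo` (`FreyRef.not_dvd_46080_of_seven_le`,
  `AbcOfSHwindowFreyRefutationP6Tier2`, BY NAME) and the certificate's `t.1 ≠ l`.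
* `FreyAdm.nonempty_thetaVolumeDatumAt_triple_interval` — **INHABITED datum types on a whole interval**: `UP`, `AdmitsCore`, (P2), (P5)
  exactly as in the list form (`FreyRef.ratPoint_triple_mem_UP`, `admitsCore_triple`, `condP2_triple`, `condP5_triple`,
  `ThetaPartII.stub_thetaData`), with the per-level arithmetic side conditions discharged STRUCTURALLY: every exponent `e_p < lo ≤ l`
  (so `l ∤ e_p`, `l ∤ e_2 − 8`) and two distinct odd primes in `Il` (so some odd `p₀ ∈ Il` differs from `l`) ⇒
  `∀ l, l.Prime → lo ≤ l → l ≤ hi → Nonempty (ThetaVolumeDatumAt (ratPoint (a/c)) l)`.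
With it a refuted band «REF ∀T lo ≤ l ≤ hi» of tens of thousands of levels is ONE short proof-only file whose theorem has the band's
own binder shape `(hl : l.Prime) (hlo : lo ≤ l) (hhi : l ≤ hi)`.
HONEST SCOPE: classical arithmetic (Euler's criterion in `𝔽_l`, Mazur's Frobenius certificate, a Tate transvection; trial-division-free
primality FILTERING by a gcd whose soundness direction is elementary) — an efficiency variant of existing kernel engines, nothing new is
claimed about any datum; «inhabited» = non-vacuity of OUR typed datum type; finitely many certificates never serve an infinite set of
levels; nothing about [IUTchIII] Cor. 3.12; no side taken on any author; typed ≠ proved; no abc claim.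
[cite: Mochizuki2012, IUTchIV Cor. 2.2 (ii) proof (P2)(P5)(P6)(P7) p. 45–46] [cite: Mazur1978, §6 Prop. 6.3 (1) (p. 153)]
[cite: MochizukiGenEll2010, Lem. 3.1 (iii) p. 14] [claim: Mochizuki2012, status: disputed] for every IUT sentence quoted.
-/

noncomputable section

open scoped Classical
open WeierstrassCurve

namespace Summit.ABC.IUTFork.Conditional

namespace FreyP6Engine

open Literature.NumberTheory.EllipticCurves Literature.NumberTheory.DiophantineGeometry.GenEll
open Literature.NumberTheory.DiophantineGeometry Literature.IUT.LogVolume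

/-- **A prime at least `lo` is coprime to every product of numbers `0 < p < lo`.** With `F` the list of all primes below `lo` this is the
soundness direction of the kernel primality filter `Nat.gcd l F.prod = 1` used by `condP6_ratPoint_interval_euler`. [folklore] -/
theorem gcd_eq_one_of_prime_of_forall_lt (F : List ℕ) {P lo l : ℕ} (hFP : F.prod = P) (hF : ∀ p ∈ F, 0 < p ∧ p < lo)
    (hl : l.Prime) (hlo : lo ≤ l) : Nat.gcd l P = 1 := by
  subst hFP
  induction F with
  | nil => simp
  | cons p F ih =>
    rw [List.prod_cons]
    have hp := hF p (List.mem_cons.2 (Or.inl rfl))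
    have hcop : Nat.Coprime l p :=
      (Nat.Prime.coprime_iff_not_dvd hl).2 fun h => by have := Nat.le_of_dvd hp.1 h; omega
    exact Nat.Coprime.mul_right hcop (ih fun r hr => hF r (List.mem_cons.2 (Or.inr hr)))

/-- **(P6) ENGINE, LIST FORM, SEVERAL EULER CERTIFICATES AT ONCE.** As `condP6_ratPoint_of_certificate_list_euler` (λ = a/c,
`E₁ = [0, −(c²+ac), 0, ac³, 0]`, ONE multiplicative prime `q`: `q ∤ c₄(E₁)`, `Δ(E₁) = q^k·D`, `q ∤ D`), but with a LIST of Frobenius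
certificates `Certs` — entries `t = (p, a_p, m)`: `p` a good prime (`p ∤ Δ(E₁)`), `a_p(E₁) = a_p`, `m = 4p − a_p²` — and per level `l ∈ L`
the side conditions `l.Prime ∧ l ∤ 46080 ∧ q ∤ l ∧ l ∤ k` together with `∃ t ∈ Certs, t.1 ≠ l ∧ (t.2.2 % l)^(l/2) % l = (l ≡ 1 mod 4 ? l−1 : 1)`
(Euler's criterion: `a_p² − 4p` is a non-residue mod `l`, so `X² − a_pX + p` is root-free mod `l`, `noroot_zmod_of_euler`). ONE kernel `decide`
serves the whole list. THEN `Cor22.CondP6 (ratPoint λ) l` for every `l ∈ L`.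
[cite: Mochizuki2012, IUTchIV Cor. 2.2 (ii) (P6) p.46] [cite: Mazur1978, §6 Prop. 6.3 (1) (p. 153)] -/
theorem condP6_ratPoint_of_certificates_euler (a c : ℕ) (ha : a ≠ 0) (hc : c ≠ 0) (hac : a ≠ c)
    (q : ℕ) (hq : q.Prime)
    (hc4 : ¬ (q : ℤ) ∣ ((⟨0, -(((c : ℕ) : ℤ) ^ 2 + (a : ℕ) * (c : ℕ)), 0, ((a : ℕ) : ℤ) * ((c : ℕ) : ℤ) ^ 3, 0⟩ : WeierstrassCurve ℤ)).c₄)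
    (k : ℕ) (hk0 : 0 < k) (D : ℤ)
    (hΔ : ((⟨0, -(((c : ℕ) : ℤ) ^ 2 + (a : ℕ) * (c : ℕ)), 0, ((a : ℕ) : ℤ) * ((c : ℕ) : ℤ) ^ 3, 0⟩ : WeierstrassCurve ℤ)).Δ = q ^ k * D)
    (hD : ¬ (q : ℤ) ∣ D)
    (Certs : List (ℕ × ℤ × ℕ))
    (hcert : ∀ t ∈ Certs, t.1.Prime ∧
      ¬ (t.1 : ℤ) ∣ ((⟨0, -(((c : ℕ) : ℤ) ^ 2 + (a : ℕ) * (c : ℕ)), 0, ((a : ℕ) : ℤ) * ((c : ℕ) : ℤ) ^ 3, 0⟩ : WeierstrassCurve ℤ)).Δ ∧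
      Literature.NumberTheory.Automorphic.frobeniusTrace
        (⟨0, -(((c : ℕ) : ℤ) ^ 2 + (a : ℕ) * (c : ℕ)), 0, ((a : ℕ) : ℤ) * ((c : ℕ) : ℤ) ^ 3, 0⟩ : WeierstrassCurve ℤ) t.1 = t.2.1 ∧
      (t.2.2 : ℤ) = 4 * t.1 - t.2.1 ^ 2)
    (L : List ℕ)
    (hside : ∀ l ∈ L, l.Prime ∧ ¬ l ∣ 46080 ∧ ¬ q ∣ l ∧ ¬ l ∣ k ∧
      ∃ t ∈ Certs, t.1 ≠ l ∧ (t.2.2 % l) ^ (l / 2) % l = if l % 4 = 1 then l - 1 else 1) :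
    ∀ l ∈ L, Cor22.CondP6 (ratPoint (((a : ℕ) : ℚ) / (c : ℕ))) l := by
  intro l hl
  obtain ⟨hlp, h46080, hql, hlk, t, ht, htl, heu⟩ := hside l hl
  obtain ⟨hp, hpΔ, hap, hm⟩ := hcert t ht
  have hl2 : l ≠ 2 := by rintro rfl; exact h46080 (by norm_num)
  haveI : Fact l.Prime := ⟨hlp⟩
  haveI : Fact t.1.Prime := ⟨hp⟩
  refine condP6_ratPoint_of_certificate a c ha hc hac l h46080 t.1 htl hpΔ ?_ q hq hql hc4 k hk0 hlk D hΔ hD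
  rw [hap]
  exact noroot_zmod_of_euler l hlp hl2 t.2.1 t.1 t.2.2 hm heu

/-- **(P6) ENGINE, INTERVAL FORM.** Data as in `condP6_ratPoint_of_certificates_euler` (λ = a/c, `E₁`, multiplicative prime `q` with
`Δ = q^k·D`, certificates `Certs`), a band `lo ≤ l ≤ hi` with `7 ≤ lo`, `q < lo`, `k < lo`, and a product `P = F.prod` of numbers
`0 < p < lo` (in use: ALL primes below `lo`, with `hi` below the square of the next prime, so that `Nat.gcd l P = 1` filters exactly the
primes of the band — only «prime ⇒ gcd = 1» is used). If ONE kernel `decide` confirms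
`∀ l ∈ List.range' lo (hi + 1 − lo), Nat.gcd l P = 1 → ∃ t ∈ Certs, t.1 ≠ l ∧ (t.2.2 % l)^(l/2) % l = (l ≡ 1 mod 4 ? l − 1 : 1)`,
THEN `Cor22.CondP6 (ratPoint λ) l` for EVERY prime `lo ≤ l ≤ hi` — with no list of levels anywhere (`l ∤ 46080`: `FreyRef.not_dvd_46080_of_seven_le`, p-Tier2 BY NAME;
`q ∤ l`, `l ∤ k`: from `q, k < lo ≤ l`). [cite: Mochizuki2012, IUTchIV Cor. 2.2 (ii) (P6) p.46] [cite: Mazur1978, §6 Prop. 6.3 (1) (p. 153)] -/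
theorem condP6_ratPoint_interval_euler (a c : ℕ) (ha : a ≠ 0) (hc : c ≠ 0) (hac : a ≠ c)
    (q : ℕ) (hq : q.Prime)
    (hc4 : ¬ (q : ℤ) ∣ ((⟨0, -(((c : ℕ) : ℤ) ^ 2 + (a : ℕ) * (c : ℕ)), 0, ((a : ℕ) : ℤ) * ((c : ℕ) : ℤ) ^ 3, 0⟩ : WeierstrassCurve ℤ)).c₄)
    (k : ℕ) (hk0 : 0 < k) (D : ℤ)
    (hΔ : ((⟨0, -(((c : ℕ) : ℤ) ^ 2 + (a : ℕ) * (c : ℕ)), 0, ((a : ℕ) : ℤ) * ((c : ℕ) : ℤ) ^ 3, 0⟩ : WeierstrassCurve ℤ)).Δ = q ^ k * D)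
    (hD : ¬ (q : ℤ) ∣ D)
    (Certs : List (ℕ × ℤ × ℕ))
    (hcert : ∀ t ∈ Certs, t.1.Prime ∧
      ¬ (t.1 : ℤ) ∣ ((⟨0, -(((c : ℕ) : ℤ) ^ 2 + (a : ℕ) * (c : ℕ)), 0, ((a : ℕ) : ℤ) * ((c : ℕ) : ℤ) ^ 3, 0⟩ : WeierstrassCurve ℤ)).Δ ∧
      Literature.NumberTheory.Automorphic.frobeniusTrace
        (⟨0, -(((c : ℕ) : ℤ) ^ 2 + (a : ℕ) * (c : ℕ)), 0, ((a : ℕ) : ℤ) * ((c : ℕ) : ℤ) ^ 3, 0⟩ : WeierstrassCurve ℤ) t.1 = t.2.1 ∧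
      (t.2.2 : ℤ) = 4 * t.1 - t.2.1 ^ 2)
    (lo hi : ℕ) (h7 : 7 ≤ lo) (hqlo : q < lo) (hklo : k < lo)
    (F : List ℕ) (P : ℕ) (hFP : F.prod = P) (hF : ∀ p ∈ F, 0 < p ∧ p < lo)
    (hcheck : ∀ l ∈ List.range' lo (hi + 1 - lo), Nat.gcd l P = 1 →
      ∃ t ∈ Certs, t.1 ≠ l ∧ (t.2.2 % l) ^ (l / 2) % l = if l % 4 = 1 then l - 1 else 1) :
    ∀ l, l.Prime → lo ≤ l → l ≤ hi → Cor22.CondP6 (ratPoint (((a : ℕ) : ℚ) / (c : ℕ))) l := by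
  intro l hlp hlo hhi
  have hmem : l ∈ List.range' lo (hi + 1 - lo) := List.mem_range'.2 ⟨l - lo, by omega, by omega⟩
  refine condP6_ratPoint_of_certificates_euler a c ha hc hac q hq hc4 k hk0 D hΔ hD Certs hcert [l] ?_ l
    (List.mem_cons.2 (Or.inl rfl))
  intro l' hl'
  rw [List.mem_singleton] at hl'
  subst hl'
  refine ⟨hlp, FreyRef.not_dvd_46080_of_seven_le hlp (by omega), ?_, ?_,
    hcheck l' hmem (gcd_eq_one_of_prime_of_forall_lt F hFP hF hlp hlo)⟩
  · intro hql
    rcases (Nat.dvd_prime hlp).1 hql with h1 | h1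
    · exact hq.one_lt.ne' h1
    · omega
  · intro hlk
    have := Nat.le_of_dvd hk0 hlk
    omega

end FreyP6Engine

namespace FreyAdm

open NumberField IsDedekindDomain Literature.IUT.LogVolume Literature.IUT.LogVolume.Cor22
open Literature.NumberTheory.DiophantineGeometry Literature.NumberTheory.DiophantineGeometry.GenEll
open Literature.NumberTheory.DiophantineGeometry.UniformABCConjecture Rat.HeightOneSpectrum
open Summit.ABC.ABC.Theorems

/-- **INHABITED datum types at the Frey–Legendre point of an abc triple, INTERVAL FORM.** For an abc triple `a + b = c` with
`(abc)² = ∏_{p ∈ Il} p^{e_p}` (`Il` duplicate-free primes, `e_p ≥ 1`), `AdmitsCore` (rational check), a band `lo ≤ l ≤ hi` with `5 ≤ lo`,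
EVERY exponent `e_p < lo` and two distinct odd primes `p₁ ≠ p₂` in `Il`, and (P6) at every prime of the band: for every prime
`lo ≤ l ≤ hi` the arithmetic side conditions of `nonempty_thetaVolumeDatumAt_triple_list` hold STRUCTURALLY (`l ∤ e_p` and
`l ∤ e_2 − 8` as `0 < e_p, e_2 − 8 < l`; an odd `p₀ ∈ Il` with `p₀ ≠ l` among `p₁, p₂`), so `UP` (`FreyRef.ratPoint_triple_mem_UP`),
`AdmitsCore`, (P2) (`condP2_triple`), (P5) (`condP5_triple`) and (P6) feed ONE application of the route's proved `ThetaPartII.stub_thetaData`: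
`Nonempty (ThetaVolumeDatumAt (ratPoint (a/c)) l)` at EVERY prime of the band — no list of levels anywhere.
[cite: Mochizuki2012, IUTchIV Cor. 2.2 (ii) proof (P2)(P5)(P6)(P7) p. 45–46] [claim: Mochizuki2012, status: disputed] -/
theorem nonempty_thetaVolumeDatumAt_triple_interval {a b c : ℕ} (h : IsABCTriple a b c) {Il : List ℕ} {e : ℕ → ℕ}
    (hI : ∀ p ∈ Il, p.Prime) (hnd : Il.Nodup) (he : ∀ p ∈ Il, e p ≠ 0)
    (hD : (a * b * c) ^ 2 = (Il.map fun p => p ^ e p).prod)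
    (hne : ∀ r ∈ coreExceptionalJ, ((256 * (c * b + a * a) ^ 3 : ℕ) : ℚ) / (((a * b * c) ^ 2 : ℕ) : ℚ) ≠ r)
    (lo hi : ℕ) (h5 : 5 ≤ lo) (hsmall : ∀ p ∈ Il, e p < lo)
    (p₁ p₂ : ℕ) (hp₁ : p₁ ∈ Il) (hp₂ : p₂ ∈ Il) (hp₁2 : p₁ ≠ 2) (hp₂2 : p₂ ≠ 2) (h12 : p₁ ≠ p₂)
    (h6 : ∀ l, l.Prime → lo ≤ l → l ≤ hi → CondP6 (ratPoint ((a : ℚ) / c)) l) :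
    ∀ l, l.Prime → lo ≤ l → l ≤ hi → Nonempty (ThetaVolumeDatumAt (ratPoint ((a : ℚ) / c)) l) := by
  intro l hlp hlo hhi
  have hl2 : ∀ p ∈ Il, p ≠ 2 → ¬ l ∣ e p := by
    intro p hp _ hdvd
    have := Nat.le_of_dvd (Nat.pos_of_ne_zero (he p hp)) hdvd
    have := hsmall p hp
    omega
  have hl8 : 2 ∈ Il → 8 < e 2 → ¬ l ∣ (e 2 - 8) := by
    intro h2 h8 hdvd
    have := Nat.le_of_dvd (by omega) hdvd
    have := hsmall 2 h2
    omega
  by_cases hp₁l : p₁ = l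
  · have hp₂l : p₂ ≠ l := fun h' => h12 (hp₁l.trans h'.symm)
    exact ThetaPartII.stub_thetaData (ratPoint ((a : ℚ) / c)) (FreyRef.ratPoint_triple_mem_UP h) l hlp (by omega)
      (admitsCore_triple h hne) (condP2_triple h hI hnd he hD hl2 hl8) (condP5_triple h hI hnd he hD hlp hp₂ hp₂2 hp₂l)
      (h6 l hlp hlo hhi)
  · exact ThetaPartII.stub_thetaData (ratPoint ((a : ℚ) / c)) (FreyRef.ratPoint_triple_mem_UP h) l hlp (by omega)
      (admitsCore_triple h hne) (condP2_triple h hI hnd he hD hl2 hl8) (condP5_triple h hI hnd he hD hlp hp₁ hp₁2 hp₁l)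
      (h6 l hlp hlo hhi)

end FreyAdm

end Summit.ABC.IUTFork.Conditional

end
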